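import Mathlib
import Summits.KontsevichZagierPeriods.Zeta5Search.Elimination.DictPencilAxis
import Summits.KontsevichZagierPeriods.Zeta5Search.Elimination.DictPencilLevelOne
import HarnessLib

/-!
# gen-1's D2 descent with BOTH dictionary-PENCIL nodes discharged (cert-1 gen 5)

HONEST FRAMING: systematic search; no irrationality claim unless certified — pure assembly of tree theorems; identities among
rational dictionary values only; nothing about integrals, sizes or irrationality; the class verdict is unchanged
(T1 NO / T2 NO / T4 YES).

OUR work (Summit side; cell `pub-zeta5`, certifier seat `cert-1`).  fam-elim g24's sharp re-routing of gen-1's level descent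
(`Elimination/PencilDescentSharp.explicitPQ_of_terminal_sharp`, E-L23b) takes the dictionary-side PENCIL relation only on the
axis ray (`DictPencilAxis`) and at the finite set of level-1 bases (`DictPencilLevelOne`).  Both are now THEOREMS:
`dictPencilAxis_holds` (fam-elim g25, E-L24, `Elimination/DictPencilAxis`) and `dictPencilLevelOne_holds` (cert-1 g5,
`Elimination/DictPencilLevelOne`).  Hence:

* **`explicitPQ_of_terminal_star`** — gen-1's `explicitPQ` follows from the cellular STAR and PENCIL families (`CellStar`,
  `CellPencil`), the dictionary STAR family (`DictStar`; by fam-elim g24's census §8 only its zero-slot strata are ever consumed)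
  and the terminal templates (`hterm`).  A CONDITIONAL edge: nothing is claimed about these remaining hypotheses.
-/

namespace Summit.KontsevichZagierPeriods.Zeta5Search.Elimination

open Summit.KontsevichZagierPeriods.Zeta5Search.WedgeDictionary
open Literature.NumberTheory.Irrationality.BrownZudilin2022 (bOfA)

/-- **gen-1's descent with the dictionary PENCIL input fully discharged**: `explicitPQ` from `CellStar`, `DictStar`,
`CellPencil` and the terminal templates alone (`explicitPQ_of_terminal_sharp` with `hAx := dictPencilAxis_holds` and
`hL1 := dictPencilLevelOne_holds`). -/
theorem explicitPQ_of_terminal_star (hcS : CellStar) (hdS : DictStar) (hcP : CellPencil)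
    (hterm : ∀ (a : Fin 8 → ℤ) (j : ℕ), Terminal a → RegionHyp a j →
      (∀ (c : Fin 8 → ℤ) (j' : ℕ), bOfA c 0 < bOfA a 0 → RegionHyp c j' → ExplicitPQAt c j') → ExplicitPQAt a j) :
    explicitPQ :=
  explicitPQ_of_terminal_sharp hcS hdS hcP dictPencilAxis_holds dictPencilLevelOne_holds hterm

end Summit.KontsevichZagierPeriods.Zeta5Search.Elimination
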